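import Summits.BirchSwinnertonDyer.BirchSwinnertonDyer.Theses.TameQuarticManinParity
import Summits.BirchSwinnertonDyer.BirchSwinnertonDyer.Theorems.TeichmullerTwistDescentPeriodLatticeIndexParity
import Summits.BirchSwinnertonDyer.Rank1Residual.X2.SplitSwitchDisplayKit
import Literature.NumberTheory.EllipticCurves.LatticeInclusionIsogenyComplexPointsProofs
import HarnessLib

/-!
# Route `TameQuarticManinParity`, LINE 25c (bsd-idea-3 g8), support R25 `ThreeKernelSandwichRigidity`
# (stmt-BirchSwinnertonDyer-22886) — PROVED BY NAME: the analytic `3`-kernel sandwich rigidity under mod-`3`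
# irreducibility

Cell `pub/bsd-wall`, D-0145 line `route-BirchSwinnertonDyer-TeichmullerTwistDescent`, seat `bsd-line-ttd-p1` g10,
working the planner-of-record's TQMP LINE 25c. BSD is NOT proved by this; Manin's conjecture is not proved by this.

## Statement (the route decl, paraphrased)

For elliptic `T, A / ℚ` with Néron-type period pairs `Λ_T, Λ_A`, `T[3]` an irreducible `Γ_ℚ`-module, and a rational
`q ≠ 0` with `qΛ_A ⊆ Λ_T` and `(3/q)Λ_T ⊆ Λ_A`: either `Λ_A = q⁻¹Λ_T` (`z ∈ Λ_A ↔ q z ∈ Λ_T`) or `Λ_A = (3/q)Λ_T`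
(`z ∈ Λ_A ↔ (q/3) z ∈ Λ_T`).

## Proof (the planner's «Route A», packaged by the tree's degree clause)

Put `M := q⁻¹Λ_T` (a period pair); the hypotheses say `3M ⊆ Λ_A ⊆ M`, so `[Λ_A : 3M] · [M : Λ_A] = [M : 3M] = 9`
(`PeriodLatticeIndexParity.relIndex_map_mulLeft_intCast_self`, this base g5). The rational lattice inclusion
`(3/q)Λ_T ⊆ Λ_A` is a `ℚ`-isogeny `φ : T → A` of degree `[Λ_A : (3/q)Λ_T] = [Λ_A : 3M]` (tree
`exists_isogeny_degree_eq_relIndex_of_isNeronLatticeOf`, Silverman VI.4.1(b) over `ℚ`), a divisor of `9`. Degree `3`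
is excluded by irreducibility (`X2.not_hasIrreducibleModPGaloisRep_of_isogeny_degree_eq`: a degree-`3` isogeny has a
rational line as kernel); degree `1` gives `Λ_A = 3M` (second disjunct) and degree `9` gives `Λ_A = M` (first disjunct),
by `AddSubgroup.relIndex_eq_one`. Design: theorems only; no definition, no named fact, no `sorry`; axioms `propext`,
`Classical.choice`, `Quot.sound`.
-/

set_option autoImplicit false
-- D-0017: single-problem summit, so `Summit.BirchSwinnertonDyer.BirchSwinnertonDyer.…` repeats a namespace BY DESIGN.
set_option linter.dupNamespace false

noncomputable section

open scoped Classical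

namespace Summit.BirchSwinnertonDyer.BirchSwinnertonDyer.Theorems.TameQuarticManinParity

open WeierstrassCurve Literature.NumberTheory.EllipticCurves Literature.NumberTheory.EllipticCurves.ModularForms
  Summit.BirchSwinnertonDyer.BirchSwinnertonDyer.Theses.TameQuarticManinParity
  Summit.BirchSwinnertonDyer.BirchSwinnertonDyer.Theorems.TeichmullerTwistDescent.PeriodLatticeIndexParity

/-- **R25 `ThreeKernelSandwichRigidity`** (stmt-BirchSwinnertonDyer-22886), by name: `3·(q⁻¹Λ_T) ⊆ Λ_A ⊆ q⁻¹Λ_T` with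
`T[3]` irreducible forces `Λ_A = q⁻¹Λ_T` or `Λ_A = 3q⁻¹Λ_T`, because the middle case is a `ℚ`-rational `3`-isogeny
`T → A`. [cite: SilvermanAEC2009, Thm. VI.4.1(b) and Cor. III.4.11] -/
theorem threeKernelSandwichRigidity_proof : ThreeKernelSandwichRigidity := by
  unfold ThreeKernelSandwichRigidity
  intro T A _ _ LT LA hT hA hirr q hq h1 h2
  haveI : Fact (Nat.Prime 3) := ⟨Nat.prime_three⟩
  haveI : Algebra.IsAlgebraic ℚ (AlgebraicClosure ℚ) := AlgebraicClosure.isAlgebraic ℚ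
  letI : Algebra (AlgebraicClosure ℚ) ℂ := (IsAlgClosed.lift : AlgebraicClosure ℚ →ₐ[ℚ] ℂ).toRingHom.toAlgebra
  haveI : IsScalarTower ℚ (AlgebraicClosure ℚ) ℂ := IsScalarTower.of_algebraMap_eq' (Subsingleton.elim _ _)
  have hqC : (q : ℂ) ≠ 0 := by exact_mod_cast hq
  have hq3 : (3 / q : ℚ) ≠ 0 := div_ne_zero (by norm_num) hq
  have hq3C : ((3 / q : ℚ) : ℂ) ≠ 0 := by exact_mod_cast hq3
  -- `M := q⁻¹ Λ_T`, `3M = (3/q) Λ_T`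
  set M : PeriodPair := LT.mulLeft ((q : ℂ)⁻¹) (inv_ne_zero hqC) with hM
  have hmemM : ∀ z : ℂ, z ∈ M.lattice ↔ (q : ℂ) * z ∈ LT.lattice := fun z ↦ by
    rw [hM, PeriodPair.mem_mulLeft_lattice, inv_inv]
  set M3 : AddSubgroup ℂ := M.lattice.toAddSubgroup.map (AddMonoidHom.mulLeft ((3 : ℤ) : ℂ)) with hM3
  have hmemM3 : ∀ z : ℂ, z ∈ M3 ↔ ((q / 3 : ℚ) : ℂ) * z ∈ LT.lattice := by
    intro z
    rw [hM3, AddSubgroup.mem_map]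
    constructor
    · rintro ⟨y, hy, rfl⟩
      rw [Submodule.mem_toAddSubgroup, hmemM] at hy
      simp only [AddMonoidHom.coe_mulLeft, Int.cast_ofNat]
      convert hy using 1
      push_cast
      field_simp
    · intro hz
      refine ⟨((q / 3 : ℚ) : ℂ) * z / (q : ℂ), ?_, ?_⟩
      · rw [Submodule.mem_toAddSubgroup, hmemM]
        convert hz using 1
        field_simp
      · simp only [AddMonoidHom.coe_mulLeft, Int.cast_ofNat]
        push_cast
        field_simp
  -- the sandwich `3M ≤ Λ_A ≤ M`
  have hAM : LA.lattice.toAddSubgroup ≤ M.lattice.toAddSubgroup := fun z hz ↦ by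
    rw [Submodule.mem_toAddSubgroup, hmemM]; exact h1 z hz
  have hM3A : M3 ≤ LA.lattice.toAddSubgroup := fun z hz ↦ by
    rw [hmemM3] at hz
    rw [Submodule.mem_toAddSubgroup]
    have h := h2 _ hz
    convert h using 1
    push_cast
    field_simp
  -- `[Λ_A : 3M] · [M : Λ_A] = [M : 3M] = 9`
  have h9 : M3.relIndex LA.lattice.toAddSubgroup * LA.lattice.toAddSubgroup.relIndex M.lattice.toAddSubgroup = 9 := by
    rw [AddSubgroup.relIndex_mul_relIndex _ _ _ hM3A hAM, hM3]
    have h := relIndex_map_mulLeft_intCast_self M (3 : ℤ)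
    simpa using h
  -- the `ℚ`-isogeny `T → A` of degree `[Λ_A : (3/q)Λ_T] = [Λ_A : 3M]`
  have hsub : (LT.mulLeft ((3 / q : ℚ) : ℂ) hq3C).lattice.toAddSubgroup = M3 := by
    ext z
    rw [Submodule.mem_toAddSubgroup, PeriodPair.mem_mulLeft_lattice, hmemM3]
    constructor <;> intro hz <;> convert hz using 2 <;> push_cast <;> field_simp
  obtain ⟨φ, -, -, -, -, hdeg⟩ := exists_isogeny_degree_eq_relIndex_of_isNeronLatticeOf hT hA hq3 h2
  rw [hsub] at hdeg
  -- `deg φ ∣ 9`, and `deg φ ≠ 3`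
  have hdvd : φ.degree ∣ 3 ^ 2 := by
    rw [hdeg]; exact Dvd.intro _ (by simpa using h9)
  obtain ⟨m, hm, hm'⟩ := (Nat.dvd_prime_pow Nat.prime_three).1 hdvd
  interval_cases m
  · -- degree 1: `Λ_A = 3M`
    right
    intro z
    have hle : LA.lattice.toAddSubgroup ≤ M3 := by
      rw [← AddSubgroup.relIndex_eq_one, ← hdeg, hm', pow_zero]
    constructor
    · intro hz
      exact (hmemM3 z).mp (hle hz)
    · intro hz
      exact hM3A ((hmemM3 z).mpr hz)
  · -- degree 3: a rational `3`-isogeny contradicts irreducibility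
    exfalso
    rw [pow_one] at hm'
    exact Summit.BirchSwinnertonDyer.Rank1Residual.X2.not_hasIrreducibleModPGaloisRep_of_isogeny_degree_eq φ hm'
      hirr
  · -- degree 9: `Λ_A = M`
    left
    intro z
    have hd9 : M3.relIndex LA.lattice.toAddSubgroup = 9 := by rw [← hdeg, hm']; norm_num
    have h1' : LA.lattice.toAddSubgroup.relIndex M.lattice.toAddSubgroup = 1 := by
      rw [hd9] at h9
      omega
    have hle : M.lattice.toAddSubgroup ≤ LA.lattice.toAddSubgroup := AddSubgroup.relIndex_eq_one.mp h1'
    constructor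
    · intro hz; exact h1 z hz
    · intro hz; exact hle ((hmemM z).mpr hz)

end Summit.BirchSwinnertonDyer.BirchSwinnertonDyer.Theorems.TameQuarticManinParity

end
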